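import Summits.FinalStateConjecture.FinalStateConjecture.Theorems.EIHFluxBalanceEIHFluxEvaluationKSVacuum
import Literature.Geometry.Lorentzian.KerrSchildHomogeneity
import Literature.Geometry.Lorentzian.KerrSchildCoord
import Literature.Geometry.Lorentzian.KerrDataProofs
import Literature.Geometry.Lorentzian.ChartMetricCoord
import Literature.Geometry.Lorentzian.LeviCivitaProofs
import Literature.Geometry.Lorentzian.KerrRicciFlat

/-!
# Route EIHFluxBalance — `EIHFluxEvaluation` (c): the Landau–Lifshitz pseudotensor, complex and
# momentum flux of the exact Kerr metric vanish identically in Kerr–Schild coordinates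

Helper file (`--supports stmt-FinalStateConjecture-10188`): clause (c) of the informal item
`EIHFluxEvaluation` for the exact Kerr family `g_{M,a} = η + 2H ℓ ⊗ ℓ` (`Kerr.bilin M a`) on the
Kerr–Schild chart domains `Kerr.region a r₀ = {r > max r₀ 0}`, UNCONDITIONALLY for every real
`M`, `a`, `r₀`:

* `Kerr.bilin M a = η + M · K_a` with `K_a = g_{1,a} − η = 2H₁ ℓ ⊗ ℓ` (`kerr_bilin_eq_ksFamily`,
  `scalarH_eq_mul_scalarH_one`): the mass IS the Kerr–Schild family parameter, and `K_a` is `C^∞`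
  with null rank-one values on `{r > 0}` (`kerr_nullRankOne`, `contDiffOn_kerr_sub_minkowski`);
* the Ricci bridge `ricAt_kerr_eq_zero`: Ricci-flatness of the Kerr metric (the tree theorem
  `Kerr.isRicciFlat_holds`, all spins, with the instance `Kerr.Facts` assembled from its three
  tree theorems) gives `MetricCoord.ricAt (Kerr.bilin M a) = 0` on the chart domain
  (`OpensChart.ricci_eq_ricAt`, O'Neill 1983 Lemma 3.52);
* hence, by the abstract Kerr–Schild vacuum theorems of `…KSVacuum`: at every point of
  `Kerr.region a r₀`, `Σ_α∂_α h^{μνα} = 0` and `t^{μν}_LL = 0`, the momentum flux through every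
  coordinate sphere in the domain is `0`, and the quasi-local four-momentum of every such sphere is
  conserved (`emComplex_kerr_eq_zero`, `pseudotensor_kerr_eq_zero`, `momentumFlux_kerr_eq_zero`,
  `hasDerivAt_quasiLocalMomentum_kerr`). Schwarzschild is the specialisation `a = 0`.

Physics: Gürses–Gürsey, J. Math. Phys. 16 (1975) 2385, §IV; Virbhadra, Phys. Rev. D 41 (1990) 1086.
-/

noncomputable section

open Filter Set
open scoped Matrix Topology ContDiff

namespace Summit.FinalStateConjecture.FinalStateConjecture.Theorems

namespace KSFlux

open Literature.Geometry.Lorentzian Literature.Geometry.Lorentzian.LandauLifshitz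
set_option maxSynthPendingDepth 3

open MeasureTheory MeasureTheory.Measure
open scoped Manifold

section KerrFamily

/-- **The mass is the Kerr–Schild family parameter**: `g_{M,a}(x) = η + M · (g_{1,a}(x) − η)`
(`H_{M,a} = M · H_{1,a}`, `scalarH_eq_mul_scalarH_one`). [cite: KerrSchild1965, §1] -/
theorem kerr_bilin_eq_ksFamily (M a : ℝ) :
    Kerr.bilin M a = fun x ↦ Minkowski.bilin + M • (Kerr.bilin 1 a x - Minkowski.bilin) := by
  funext x
  rw [Kerr.bilin, Kerr.bilin, Kerr.scalarH_eq_mul_scalarH_one M a x, add_sub_cancel_left,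
    smul_smul]
  congr 1
  congr 1
  ring

/-- **`K_a = g_{1,a} − η = 2H₁ ℓ ⊗ ℓ` is null rank-one wherever `r > 0`** (`ℓ` the Kerr–Schild null
covector, `ℓ♯` its `η`-dual, `ℓ(ℓ♯) = 0`). [cite: KerrSchild1965, §1] -/
theorem kerr_nullRankOne (a : ℝ) {x : E4} (hx : 0 < Kerr.radius a x) :
    ∃ φ : ℝ, ∃ ℓ : E4 →L[ℝ] ℝ, ∃ n : E4, (∀ w, Minkowski.bilin n w = ℓ w) ∧ ℓ n = 0 ∧
      Kerr.bilin 1 a x - Minkowski.bilin = φ • E4.tmul ℓ ℓ :=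
  ⟨2 * Kerr.scalarH 1 a x, Kerr.nullCovector a x, Kerr.nullVector a x, Kerr.bilin_nullVector a x,
    Kerr.nullCovector_nullVector hx, by rw [Kerr.bilin, add_sub_cancel_left]⟩

/-- `K_a = g_{1,a} − η` is `C^∞` on the chart domains `Kerr.region a r₀`.
[cite: KerrSchild1965, §3] -/
theorem contDiffOn_kerr_sub_minkowski (a r₀ : ℝ) :
    ContDiffOn ℝ ∞ (fun x ↦ Kerr.bilin 1 a x - Minkowski.bilin) (Kerr.region a r₀ : Set E4) :=
  fun _ hx ↦ ((Kerr.contDiffAt_bilin 1 a (Kerr.radius_pos_of_mem_region hx)).sub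
    contDiffAt_const).contDiffWithinAt

/-- **The Ricci bridge for Kerr**: the coordinate Ricci form of the Kerr components vanishes on
the chart domain, `MetricCoord.ricAt (Kerr.bilin M a) x = 0` for `x ∈ Kerr.region a r₀`, for all
real `M, a, r₀` — Ricci-flatness of the Kerr metric (tree theorem `Kerr.isRicciFlat_holds`, with
`Kerr.Facts` assembled from `Kerr.isConnected_region_holds`, `Kerr.contMDiff_bilin_holds`,
`Kerr.contMDiff_timeVector_holds`) read in the chart (O'Neill 1983, Lemma 3.52,
`OpensChart.ricci_eq_ricAt`). [cite: ONeill1983, Ch. 3, Lemma 3.52] -/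
theorem ricAt_kerr_eq_zero (M a r₀ : ℝ) {x : E4} (hx : x ∈ Kerr.region a r₀) :
    MetricCoord.ricAt (Kerr.bilin M a) x = 0 := by
  haveI : Kerr.Facts :=
    ⟨Kerr.isConnected_region_holds, Kerr.contMDiff_bilin_holds, Kerr.contMDiff_timeVector_holds⟩
  set g := (Kerr.smoothMetric M a r₀).toPseudoRiemannianMetric with hg
  haveI hLC : g.HasLeviCivita := g.hasLeviCivita
  haveI : (Kerr.metric M a r₀).HasLeviCivita := hLC
  have hrepr : ∀ y : Kerr.region a r₀, g.val y = Kerr.bilin M a y.1 := fun y ↦ rfl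
  have h0 : g.ricci ⟨x, hx⟩ = 0 := Kerr.isRicciFlat_holds M a r₀ ⟨x, hx⟩
  ext v w
  rw [← OpensChart.ricci_eq_ricAt hrepr ⟨x, hx⟩ v w, h0]
  rfl

/-- On the chart domain the Kerr components are vacuum parameters of the Kerr–Schild family
`η + M K_a` for EVERY mass. [cite: KerrSchild1965, §3] -/
theorem ricAt_kerr_ksFamily_eq_zero (a r₀ : ℝ) {x : E4} (hx : x ∈ Kerr.region a r₀) :
    ∀ s ∈ (Set.univ : Set ℝ), MetricCoord.ricAt
      (fun z ↦ Minkowski.bilin + s • (Kerr.bilin 1 a z - Minkowski.bilin)) x = 0 := fun s _ ↦ by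
  rw [← kerr_bilin_eq_ksFamily s a]
  exact ricAt_kerr_eq_zero s a r₀ hx

/-- `0` is an accumulation point of the nonzero masses. [folklore] -/
theorem zero_mem_closure_univ_diff : (0 : ℝ) ∈ closure ((Set.univ : Set ℝ) \ {0}) := by
  rw [← Set.compl_eq_univ_sdiff, (dense_compl_singleton (0 : ℝ)).closure_eq]
  exact Set.mem_univ _

/-- **The Landau–Lifshitz complex of the exact Kerr metric vanishes identically in Kerr–Schild
coordinates**: `Σ_α ∂_α h^{μνα}(g_{M,a})(x) = 0` on `Kerr.region a r₀`, for all real `M, a, r₀`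
(unconditional; Ricci-flatness from `Kerr.isRicciFlat_holds`).
[cite: LandauLifshitz1975, §96 (96.8)] -/
theorem emComplex_kerr_eq_zero (M a r₀ : ℝ) {x : E4} (hx : x ∈ Kerr.region a r₀) (μ ν : Fin 4) :
    emComplex (Kerr.bilin M a) x μ ν = 0 := by
  rw [kerr_bilin_eq_ksFamily M a]
  exact emComplex_ksFamily_eq_zero (Kerr.region a r₀).isOpen (contDiffOn_kerr_sub_minkowski a r₀)
    (fun y hy ↦ kerr_nullRankOne a (Kerr.radius_pos_of_mem_region hy)) hx
    (ricAt_kerr_ksFamily_eq_zero a r₀ hx) zero_mem_closure_univ_diff M μ ν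

/-- **The Landau–Lifshitz pseudotensor of the exact Kerr metric vanishes identically in
Kerr–Schild coordinates**: `t^{μν}_LL(g_{M,a})(x) = 0` on `Kerr.region a r₀`, for all real
`M, a, r₀` (Gürses–Gürsey 1975, §IV; unconditional, Ricci-flatness from `Kerr.isRicciFlat_holds`).
[cite: LandauLifshitz1975, §96 (96.7)] -/
theorem pseudotensor_kerr_eq_zero (M a r₀ : ℝ) {x : E4} (hx : x ∈ Kerr.region a r₀)
    (μ ν : Fin 4) : pseudotensor (Kerr.bilin M a) x μ ν = 0 := by
  rw [kerr_bilin_eq_ksFamily M a]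
  exact pseudotensor_ksFamily_eq_zero (Kerr.region a r₀).isOpen (contDiffOn_kerr_sub_minkowski a r₀)
    (fun y hy ↦ kerr_nullRankOne a (Kerr.radius_pos_of_mem_region hy)) hx
    (ricAt_kerr_ksFamily_eq_zero a r₀ hx) zero_mem_closure_univ_diff
    (ricAt_kerr_ksFamily_eq_zero a r₀ hx M (Set.mem_univ _)) μ ν

/-- **The Landau–Lifshitz momentum flux of the exact Kerr metric through any coordinate sphere in
the chart domain vanishes**: `Φ^μ(t; ξ, R) = ∮ Σ_k (−g) t^{μk}_LL n_k dσ = 0`, for all real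
`M, a, r₀` (unconditional). [cite: LandauLifshitz1975, §96 (96.11)] -/
theorem momentumFlux_kerr_eq_zero (M a r₀ : ℝ) {t R : ℝ} {ξ : E3}
    (hsph : ∀ y ∈ Metric.sphere ξ R, E4.ofTimeSpace t y ∈ (Kerr.region a r₀ : Set E4)) (μ : Fin 4) :
    momentumFlux (Kerr.bilin M a) t ξ R μ = 0 := by
  rw [kerr_bilin_eq_ksFamily M a]
  exact momentumFlux_ksFamily_eq_zero (Kerr.region a r₀).isOpen (contDiffOn_kerr_sub_minkowski a r₀)
    (fun y hy ↦ kerr_nullRankOne a (Kerr.radius_pos_of_mem_region hy))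
    (fun s hs y hy ↦ ricAt_kerr_ksFamily_eq_zero a r₀ hy s hs) zero_mem_closure_univ_diff
    (Set.mem_univ M) hsph μ

/-- **The quasi-local Landau–Lifshitz four-momentum of any coordinate sphere in the chart domain is
conserved for the exact Kerr metric**: `d/dt P^μ(t; ξ, R) = 0` (`R > 0`), for all real `M, a, r₀`
(unconditional; LL (96.16) with the complex identically zero).
[cite: LandauLifshitz1975, §96 (96.16)] -/
theorem hasDerivAt_quasiLocalMomentum_kerr (M a r₀ : ℝ) {t R : ℝ} {ξ : E3} (hR : 0 < R)
    (hsph : ∀ y ∈ Metric.sphere ξ R, E4.ofTimeSpace t y ∈ (Kerr.region a r₀ : Set E4)) (μ : Fin 4) :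
    HasDerivAt (fun t' ↦ quasiLocalMomentum (Kerr.bilin M a) t' ξ R μ) 0 t := by
  rw [kerr_bilin_eq_ksFamily M a]
  exact hasDerivAt_quasiLocalMomentum_ksFamily (Kerr.region a r₀).isOpen
    (contDiffOn_kerr_sub_minkowski a r₀)
    (fun y hy ↦ kerr_nullRankOne a (Kerr.radius_pos_of_mem_region hy))
    (fun s hs y hy ↦ ricAt_kerr_ksFamily_eq_zero a r₀ hy s hs) zero_mem_closure_univ_diff M hR
    hsph μ

end KerrFamily

end KSFlux

end Summit.FinalStateConjecture.FinalStateConjecture.Theorems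

end
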